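import Mathlib

/-!
# Möbius perturbation identity and the two-sided discrete Duhamel ("sandwich") formula

Kernel #219 of the solo-blind programme (lemmaR-A5 §20 (11)): the algebra behind the rigorous
Taylor-model continued-fraction engine.  (1) For a step `R ↦ -(X + L δ)⁻¹ N` of a matrix Möbius
map, the difference of two evaluations is the sandwich `X⁻¹ L δ (X + L δ)⁻¹ N`.  (2) A linear
two-sided recursion `e m = c m - G m * e (m+1) * P m` unrolls into an alternating sum of
sandwiched sources plus the sandwiched boundary value.  Everything is stated in an arbitrary
(noncommutative) ring; signs are carried as `ℤ`-scalars so that they commute with everything.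
-/

namespace Summit.AnomalousDissipation.AnomalousDissipation.Theorems

/-- Möbius perturbation identity: if `Xi` is a left inverse of `X` and `Yi` a right inverse of
`X + L * δ`, then `-(Yi * N) - (-(Xi * N)) = Xi * L * δ * Yi * N`; i.e. the values of the
Möbius step `R ↦ -(B + L R)⁻¹ N` at `R + δ` and at `R` differ by the sandwich of `δ`. -/
theorem mobius_perturbation_identity {R : Type*} [Ring R] (X L δ N Xi Yi : R)
    (hX : Xi * X = 1) (hY : (X + L * δ) * Yi = 1) :
    -(Yi * N) - (-(Xi * N)) = Xi * L * δ * Yi * N := by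
  have h2 : Xi * ((X + L * δ) * Yi) = Yi + Xi * L * δ * Yi := by
    have : Xi * ((X + L * δ) * Yi) = (Xi * X) * Yi + Xi * L * δ * Yi := by
      simp only [add_mul, mul_add, mul_assoc]
    rw [this, hX, one_mul]
  have h3 : Xi = Yi + Xi * L * δ * Yi := by rw [← h2, hY, mul_one]
  have key : Xi - Yi = Xi * L * δ * Yi := by
    calc Xi - Yi = (Yi + Xi * L * δ * Yi) - Yi := by rw [← h3]
      _ = Xi * L * δ * Yi := by abel
  have : -(Yi * N) - (-(Xi * N)) = (Xi - Yi) * N := by rw [sub_mul]; abel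
  rw [this, key]

/-- Prepending a factor to the ordered product `G j * G (j+1) * ⋯ * G (j+n-1)`. -/
theorem sandwich_prodL_succ {R : Type*} [Ring R] (G : ℕ → R) (j n : ℕ) :
    ((List.range (n + 1)).map (fun i => G (j + i))).prod
      = G j * ((List.range n).map (fun i => G (j + 1 + i))).prod := by
  rw [List.range_succ_eq_map, List.map_cons, List.map_map, List.prod_cons]
  have hm : (List.range n).map ((fun i => G (j + i)) ∘ Nat.succ) = (List.range n).map (fun i => G (j + 1 + i)) :=
    List.map_congr_left (fun i _ => by simp only [Function.comp_apply, Nat.succ_eq_add_one]; congr 1; ring)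
  rw [hm, Nat.add_zero]

/-- Appending a factor to the reversed ordered product `P (j+n-1) * ⋯ * P (j+1) * P j`. -/
theorem sandwich_prodR_succ {R : Type*} [Ring R] (P : ℕ → R) (j n : ℕ) :
    ((List.range (n + 1)).map (fun i => P (j + i))).reverse.prod
      = ((List.range n).map (fun i => P (j + 1 + i))).reverse.prod * P j := by
  rw [List.range_succ_eq_map, List.map_cons, List.map_map, List.reverse_cons, List.prod_append,
    List.prod_singleton]
  have hm : (List.range n).map ((fun i => P (j + i)) ∘ Nat.succ) = (List.range n).map (fun i => P (j + 1 + i)) :=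
    List.map_congr_left (fun i _ => by simp only [Function.comp_apply, Nat.succ_eq_add_one]; congr 1; ring)
  rw [hm]
  simp

/-- Two-sided discrete Duhamel (sandwich) formula.  If `e m = c m - G m * e (m+1) * P m` for all
`m` with `j ≤ m < j + k`, then
`e j = Σ_{i<k} (-1)^i • (G j ⋯ G (j+i-1)) c (j+i) (P (j+i-1) ⋯ P j) + (-1)^k • (G j ⋯ G (j+k-1)) e (j+k) (P (j+k-1) ⋯ P j)`
(ordered products, signs as `ℤ`-scalars).  This is the identity by which the engine propagates
the local truncation defects `c m = d m + r m` through the oscillatory levels exactly, instead of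
multiplying per-level norms. -/
theorem sandwich_unrolling {R : Type*} [Ring R] (G P c e : ℕ → R) :
    ∀ k j : ℕ, (∀ m, j ≤ m → m < j + k → e m = c m - G m * e (m + 1) * P m) →
      e j = (Finset.range k).sum (fun i => ((-1 : ℤ) ^ i) •
              (((List.range i).map (fun l => G (j + l))).prod * c (j + i) *
               ((List.range i).map (fun l => P (j + l))).reverse.prod))
            + ((-1 : ℤ) ^ k) • (((List.range k).map (fun l => G (j + l))).prod * e (j + k) *
               ((List.range k).map (fun l => P (j + l))).reverse.prod) := by
  intro k
  induction k with
  | zero =>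
      intro j _
      simp
  | succ k ih =>
      intro j h
      have hj : e j = c j - G j * e (j + 1) * P j := h j le_rfl (by omega)
      have hih := ih (j + 1) (fun m hm1 hm2 => h m (by omega) (by omega))
      -- name the sandwiched quantities at base point j+1
      set X : ℕ → R := fun i => ((List.range i).map (fun l => G (j + 1 + l))).prod * c (j + 1 + i) *
               ((List.range i).map (fun l => P (j + 1 + l))).reverse.prod with hXdef
      set Y : R := ((List.range k).map (fun l => G (j + 1 + l))).prod * e (j + 1 + k) *
               ((List.range k).map (fun l => P (j + 1 + l))).reverse.prod with hYdef
      have hih' : e (j + 1) = (Finset.range k).sum (fun i => ((-1 : ℤ) ^ i) • X i) + ((-1 : ℤ) ^ k) • Y := by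
        rw [hih]
      -- prepend / append lemmas for the (i+1)-fold products
      have eG : ∀ i, ((List.range (i + 1)).map (fun l => G (j + l))).prod
          = G j * ((List.range i).map (fun l => G (j + 1 + l))).prod :=
        fun i => sandwich_prodL_succ G j i
      have eP : ∀ i, ((List.range (i + 1)).map (fun l => P (j + l))).reverse.prod
          = ((List.range i).map (fun l => P (j + 1 + l))).reverse.prod * P j :=
        fun i => sandwich_prodR_succ P j i
      have e1 : ∀ i : ℕ, j + (i + 1) = j + 1 + i := fun i => by ring
      -- each shifted summand is -(G j * ((-1)^i • X i) * P j); the boundary term likewise with Y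
      have tX : ∀ i : ℕ, ((-1 : ℤ) ^ (i + 1)) • ((((List.range (i + 1)).map (fun l => G (j + l))).prod * c (j + (i + 1)) *
              ((List.range (i + 1)).map (fun l => P (j + l))).reverse.prod))
            = -(G j * (((-1 : ℤ) ^ i) • X i) * P j) := by
        intro i
        rw [eG, eP, e1 i, pow_succ, mul_neg_one, neg_smul, mul_smul_comm, smul_mul_assoc, hXdef]
        congr 2
        simp only [mul_assoc]
      have tY : ((-1 : ℤ) ^ (k + 1)) • ((((List.range (k + 1)).map (fun l => G (j + l))).prod * e (j + (k + 1)) *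
              ((List.range (k + 1)).map (fun l => P (j + l))).reverse.prod))
            = -(G j * (((-1 : ℤ) ^ k) • Y) * P j) := by
        rw [eG, eP, e1 k, pow_succ, mul_neg_one, neg_smul, mul_smul_comm, smul_mul_assoc, hYdef]
        congr 2
        simp only [mul_assoc]
      have hsum : (Finset.range k).sum (fun i => ((-1 : ℤ) ^ (i + 1)) • ((((List.range (i + 1)).map (fun l => G (j + l))).prod *
              c (j + (i + 1)) * ((List.range (i + 1)).map (fun l => P (j + l))).reverse.prod)))
            = (Finset.range k).sum (fun i => -(G j * (((-1 : ℤ) ^ i) • X i) * P j)) :=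
        Finset.sum_congr rfl (fun i _ => tX i)
      simp only [Finset.sum_range_succ']
      rw [hsum, tY]
      simp only [pow_zero, one_smul, List.range_zero, List.map_nil, List.prod_nil, List.reverse_nil,
        mul_one, one_mul, Nat.add_zero]
      rw [hj, hih']
      simp only [mul_add, add_mul, Finset.mul_sum, Finset.sum_mul, Finset.sum_neg_distrib]
      abel

end Summit.AnomalousDissipation.AnomalousDissipation.Theorems
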